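import Literature.AlgebraicGeometry.Resolution.ControlledTransformBaseChange
import Literature.AlgebraicGeometry.Resolution.BlowupsRelativeCartier
import Literature.AlgebraicGeometry.Resolution.SncModelSpread
import Literature.AlgebraicGeometry.Resolution.BlowupChartMembership
import Literature.AlgebraicGeometry.Resolution.CoefficientIdealRestriction
import Literature.AlgebraicGeometry.Resolution.HypersurfaceTransform
import Literature.AlgebraicGeometry.Resolution.MarkedIdealsLemmas
import Literature.AlgebraicGeometry.Resolution.StalkIdealLemmas
import Literature.AlgebraicGeometry.Resolution.StrictTransformSupport
import HarnessLib

/-!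
# EL♮(3) / EL♮(n), RUNG LC «large characteristic» — brick LC-FIB (f1), FIBRE SIDE: the strict transform of the running hypersurface commutes with
# passage to the fibre when the exceptional divisor and its trace on the strict transform are flat over the base

leafhand-res-equisingularlift-3 g0 (prover, 2026-08-31; one-generation line-first hand on stmt-ResolutionOfSingularities-20148 / -20038 /
-15660, cell `pub/decomp-res`).  Crux `EquisingularLiftNatThree` (`stmt-…-20148`; uniform in `n`, so also `stmt-…-20038`), line W4.5(b), RUNG LC
(idea-2 g32 `Cruxes/EquisingularLiftNatThree/LARGE-CHAR-RUNG-idea2.md` v1.6 §(B3″) «CARTIER VARIANT of (f1), RECOMMENDED PRIMARY»: (t1) on the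
B-side, by LC-ST ✓p731216, `π^*𝓣 = Eᵐ · 𝓣'` with `𝓣'` the strict transform, again principal; (t2) generic flatness makes `V(𝓣')` and `V(𝓣') ∩ E`
flat over the base after shrinking; (t3) LC-RELCARTIER-FIBRE = ✓ `IsEffectiveCartier.comap_fst_of_flat_subschemeι` (Stacks 056P (1)): a relative
effective Cartier divisor stays Cartier in every fibre; THEN (f1) «the fibre of the B-side strict transform is the k-side strict transform»).
The k-fibre clause ✓ `DescTransformOK` of the point-wise door runs on the k-side sets `Y_{i+1} = closure (π_k⁻¹ (Y_i ∖ C_k))`, which are the supports of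
the k-side strict-transform ideals (✓ `support_strictTransformIdeal_eq_closure`, any morphism); LC-FIB is the statement that these are the fibres of
the B-side strict-transform ideals `𝓣_{i+1} = strictTransformIdeal π C 𝓣_i`.  The tree's ✓ `comap_strictTransformIdeal_of_isEffectiveCartier`
(…ControlledTransformBaseChange :168, the non-flat companion of the flat base change) proves exactly that from five hypotheses; this file DISCHARGES
its three fibre-side hypotheses from B-side data that spread (flatness) and proves, DEF-FREE:

* `colon_eq_self_of_isEffectiveCartier_comap_subschemeι` — **saturation from a Cartier trace**: on a locally Noetherian scheme, if `P` restricts to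
  an effective Cartier divisor on the closed subscheme `V(K)` then `(K : P) = K` (stalkwise: the generator of `P·𝒪_{V(K),z}` is a non-zero-divisor of
  `𝒪_{X,x}/K_x`, ✓ `IsEffectiveCartier.exists_stalkIdeal_eq_span`, ✓ `ker_stalkMap_subschemeι`, ✓ `stalkIdeal_colon`);
* `isEffectiveCartier_comap_comap_subschemeι_of_flat` — **the trace of the exceptional divisor on the FIBRE of the strict transform is Cartier**
  when `E ∩ V(𝓣')` is Cartier in `V(𝓣')` and FLAT over the base: (t3) on the `B`-scheme `V(𝓣')` (its fibre is `V(s^*𝓣')`, ✓ `isPullback_subschemeMap_comap`)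
  + Mathlib `subschemeMap_subschemeι` / `comap_comp`;
* ★ `comap_strictTransformIdeal_of_flat_traces` — **LC-FIB, one blow-up, fibre side**: for a blow-up `π : Z → Y` of the `B`-scheme `q : Y → Spec B`
  along `C`, the fibre square `s : Z_k → Z`, `t : Y_k → Y` over a point `Spec k → Spec B` (`s ≫ π = π_k ≫ t`, `Z_k = Z ×_B k` cartesian), and a
  running ideal `𝓣` with `π^*𝓣 = (π^*C)ᵐ · 𝓣'` EXACTLY (LC-ST on the B-side), `E ∩ V(𝓣')` Cartier in `V(𝓣')`, and `E = V(π^*C)`,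
  `E ∩ V(𝓣')` FLAT over `Spec B`: `s^*(strictTransformIdeal π C 𝓣) = strictTransformIdeal π_k (t^*C) (t^*𝓣)` — hence (with
  ✓ `support_strictTransformIdeal_eq_closure`) the k-side running set IS the fibre of `V(𝓣')`.

WHAT REMAINS of LC-FIB (honest): the B-SIDE inputs along the tower — the exact-multiple form `π^*𝓣ᵢ = Eᵐ·𝓣ᵢ₊₁` after the order-constancy shrink
((t1): ✓ LC-ST `controlledTransform_eq_strictTransformIdeal_of_idealOrder_le` + ✓ `isClosed_setOf_le_idealOrder`), the B-side Cartier trace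
(`𝓣ᵢ₊₁` is `E`-saturated by construction — to be read off ✓ `strictTransformIdeal` as `(𝓣' : E) = 𝓣'`, then this file's first lemma in reverse is
NOT needed: saturation ⇒ Cartier trace needs `V(𝓣')` without embedded `E`-components, i.e. the non-zero-divisor form; M), the flatness of `E ∩ V(𝓣ᵢ₊₁)`
over `D(a)` ((t2): scheme-level generic flatness ✓ `Morphisms/GenericFlatness.exists_flat_morphismRestrict_basicOpen` + restriction/base-change plumbing,
M), the position token (f3) by fibre dimension (M), and the (B5) assembly (M).  EL♮(3) NOT proved; EL♮ NOT proved; resolution of singularities in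
positive characteristic NOT proved; nothing of [Hironaka2017] (a candidate under adjudication) is asserted or used.  [OURS · bookkeeping over tree
lemmas · standard axioms · DEF-FREE · `--supports stmt-ResolutionOfSingularities-20148 --as helper`, counted 0 · AI-written, weaker than expert review.]
[cite: StacksProject, Tag 056P (1)] [cite: GortzWedhorn2020, (13.19)] [cite: BierstoneGrigorievMilmanWlodarczyk2011, Def. 3.1.3 (3)–(5)] (method; index only)
-/

noncomputable section

open CategoryTheory CategoryTheory.Limits AlgebraicGeometry TopologicalSpace
open AlgebraicGeometry.Scheme.IdealSheafData

namespace Literature.AlgebraicGeometry.Resolution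

universe u

/-! ## Saturation from a Cartier trace -/

section Saturation

variable {X : Scheme.{u}} [IsLocallyNoetherian X]

/-- **`(K : P) = K` when `P` restricts to an effective Cartier divisor on `V(K)`** (locally Noetherian `X`): at a point `x = ι z` of `V(K)` the
ideal `P·𝒪_{V(K),z} = (P_x)·(𝒪_{X,x}/K_x)` is generated by a non-zero-divisor `g` (✓ `IsEffectiveCartier.exists_stalkIdeal_eq_span`); if `a·P_x ⊆ K_x`
then `ā·g = 0` in `𝒪_{V(K),z}`, so `ā = 0`, i.e. `a ∈ K_x = ker (𝒪_{X,x} → 𝒪_{V(K),z})` (✓ `ker_stalkMap_subschemeι`); stalks of colons by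
✓ `stalkIdeal_colon`, and inclusions are stalkwise (✓ `le_of_forall_stalkIdeal_le`). [folklore] -/
theorem colon_eq_self_of_isEffectiveCartier_comap_subschemeι (K P : X.IdealSheafData)
    (h : IsEffectiveCartier (P.comap K.subschemeι)) : colon K P = K := by
  refine le_antisymm (le_of_forall_stalkIdeal_le fun x => ?_) (le_colon_self K P)
  by_cases hx : x ∈ K.support
  · obtain ⟨z, rfl⟩ : x ∈ Set.range K.subschemeι := by rw [range_subschemeι]; exact hx
    obtain ⟨g, hg, hgen⟩ := h.exists_stalkIdeal_eq_span z
    rw [stalkIdeal_comap_eq_map_stalkMap] at hgen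
    intro a ha
    rw [stalkIdeal_colon] at ha
    -- `g` is the image of some `p ∈ P_x` (the stalk map of a closed immersion is surjective)
    have hsurj : Function.Surjective (K.subschemeι.stalkMap z).hom := K.subschemeι.stalkMap_surjective z
    have hgmem : g ∈ (stalkIdeal P (K.subschemeι z)).map (K.subschemeι.stalkMap z).hom := by
      rw [hgen]; exact Ideal.mem_span_singleton_self g
    obtain ⟨p, hp, hpg⟩ := (Ideal.mem_map_iff_of_surjective _ hsurj).mp hgmem
    -- `a p ∈ K_x = ker`, so `ā g = 0`, so `ā = 0`
    have hap : a * p ∈ stalkIdeal K (K.subschemeι z) := by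
      have := Submodule.mem_colon.mp ha p hp
      rwa [smul_eq_mul] at this
    rw [← ker_stalkMap_subschemeι, RingHom.mem_ker] at hap ⊢
    rw [map_mul, hpg] at hap
    exact (mem_nonZeroDivisors_iff_right.mp hg) _ hap
  · rw [stalkIdeal_eq_top_of_not_mem_support hx]
    exact le_top

end Saturation

/-! ## The Cartier trace of the exceptional divisor on the fibre of the strict transform -/

section Trace

variable {B : Type u} (k : Type u) [CommRing B] [CommRing k] [Algebra B k]
  {Z Zk : Scheme.{u}} (qZ : Z ⟶ Spec (.of B)) {s : Zk ⟶ Z} {qZk : Zk ⟶ Spec (.of k)}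
  (HZ : IsPullback s qZk qZ (specOfAlgebra B k))

include HZ in
/-- **The trace of `E` on the fibre of `V(𝓣')` is an effective Cartier divisor** when the trace `E ∩ V(𝓣')` is Cartier in `V(𝓣')` and FLAT over
`Spec B`: the fibre of the `B`-scheme `V(𝓣')` in the square `Z_k = Z ×_B Spec k` is `V(s^*𝓣')` (✓ `isPullback_subschemeMap_comap`), relative effective
Cartier divisors stay Cartier in fibres (✓ `IsEffectiveCartier.comap_fst_of_flat_subschemeι`, Stacks 056P (1)), and
`(E·𝒪_{V(𝓣')})·𝒪_{V(s^*𝓣')} = (s^*E)·𝒪_{V(s^*𝓣')}` (Mathlib `subschemeMap_subschemeι`, `comap_comp`). [cite: StacksProject, Tag 056P (1)] -/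
theorem isEffectiveCartier_comap_comap_subschemeι_of_flat (T' E : Z.IdealSheafData)
    (hcart : IsEffectiveCartier (E.comap T'.subschemeι)) [Flat ((E.comap T'.subschemeι).subschemeι ≫ T'.subschemeι ≫ qZ)] :
    IsEffectiveCartier ((E.comap s).comap (T'.comap s).subschemeι) := by
  have hsq := isPullback_subschemeMap_comap k qZ T' HZ
  have h := IsEffectiveCartier.comap_fst_of_flat_subschemeι k (T'.subschemeι ≫ qZ) hcart hsq
  rw [← comap_comp, subschemeMap_subschemeι, comap_comp] at h
  exact h

end Trace

/-! ## LC-FIB, one blow-up, fibre side -/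

section OneStep

variable {B : Type u} (k : Type u) [CommRing B] [CommRing k] [Algebra B k]
  {Y Yk Z Zk : Scheme.{u}} [IsLocallyNoetherian Z] [IsLocallyNoetherian Zk]
  (t : Yk ⟶ Y) {π : Z ⟶ Y} {πk : Zk ⟶ Yk} {s : Zk ⟶ Z} (hsq : s ≫ π = πk ≫ t)
  (qZ : Z ⟶ Spec (.of B)) {qZk : Zk ⟶ Spec (.of k)} (HZ : IsPullback s qZk qZ (specOfAlgebra B k))

include hsq HZ in
/-- ★ **LC-FIB (one blow-up, fibre side): the strict transform of the running hypersurface commutes with passage to the fibre.**  Data: a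
commutative square `s ≫ π = π_k ≫ t` (the blow-up `π` of the `B`-scheme `Y` along `C`, its fibre `π_k`, the fibre inclusions `t`, `s`) whose top
`Z_k = Z ×_{Spec B} Spec k` is cartesian (`HZ`), `Z`, `Z_k` locally Noetherian; the exceptional ideal `E = π^*C` an effective Cartier divisor with
`V(E) → Spec B` FLAT; a running ideal `𝓣` with `π^*𝓣 = Eᵐ · 𝓣'` EXACTLY and the trace `E ∩ V(𝓣')` an effective Cartier divisor in `V(𝓣')`, FLAT over
`Spec B`.  Conclusion: `s^* (strictTransformIdeal π C 𝓣) = strictTransformIdeal π_k (t^*C) (t^*𝓣)`.  Proof: ✓ `comap_strictTransformIdeal_of_isEffectiveCartier`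
with `hK'` and `hK's` from `colon_eq_self_of_isEffectiveCartier_comap_subschemeι` (B-side trace, resp. its fibre by
`isEffectiveCartier_comap_comap_subschemeι_of_flat`) and `hDs` from ✓ `IsEffectiveCartier.comap_fst_of_flat_subschemeι` for `E` itself.
[cite: StacksProject, Tag 056P (1)] [cite: GortzWedhorn2020, (13.19)] [OURS · L1 W4.5b · RUNG LC (B3″)(f1) fibre side; EL♮(3) NOT proved] -/
theorem comap_strictTransformIdeal_of_flat_traces (C T : Y.IdealSheafData) {T' : Z.IdealSheafData} {m : ℕ}
    (hE : IsEffectiveCartier (C.comap π)) [Flat ((C.comap π).subschemeι ≫ qZ)]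
    (hmul : C.comap π ^ m * T' = T.comap π)
    (htrace : IsEffectiveCartier ((C.comap π).comap T'.subschemeι))
    [Flat ((((C.comap π).comap T'.subschemeι)).subschemeι ≫ T'.subschemeι ≫ qZ)] :
    (strictTransformIdeal π C T).comap s = strictTransformIdeal πk (C.comap t) (T.comap t) := by
  -- the exceptional divisor stays Cartier on the fibre (it is `B`-flat)
  have hDs : IsEffectiveCartier ((C.comap π).comap s) := IsEffectiveCartier.comap_fst_of_flat_subschemeι k qZ hE HZ
  -- the B-side strict transform is `E`-saturated (Cartier trace)
  have hK' : colon T' (C.comap π) = T' := colon_eq_self_of_isEffectiveCartier_comap_subschemeι T' (C.comap π) htrace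
  -- and so is its fibre (the trace is a relative effective Cartier divisor)
  have hK's : colon (T'.comap s) ((C.comap π).comap s) = T'.comap s :=
    colon_eq_self_of_isEffectiveCartier_comap_subschemeι (T'.comap s) ((C.comap π).comap s)
      (isEffectiveCartier_comap_comap_subschemeι_of_flat k qZ HZ T' (C.comap π) htrace)
  exact comap_strictTransformIdeal_of_isEffectiveCartier t hsq C T hE hmul hK' hDs hK's

include hsq HZ in
/-- **… at the level of the k-side running sets**: under the same hypotheses the support of the fibre of the B-side strict transform is the k-side
topological strict transform `closure (π_k⁻¹ (supp t^*𝓣 ∖ supp t^*C))` — the running set of ✓ `DescTransformOK` (✓ `support_strictTransformIdeal_eq_closure`).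
[cite: GortzWedhorn2020, (13.19)] [OURS · L1 W4.5b · RUNG LC (B3″)(f1) fibre side; EL♮(3) NOT proved] -/
theorem support_comap_strictTransformIdeal_of_flat_traces (C T : Y.IdealSheafData) {T' : Z.IdealSheafData} {m : ℕ}
    (hE : IsEffectiveCartier (C.comap π)) [Flat ((C.comap π).subschemeι ≫ qZ)]
    (hmul : C.comap π ^ m * T' = T.comap π)
    (htrace : IsEffectiveCartier ((C.comap π).comap T'.subschemeι))
    [Flat ((((C.comap π).comap T'.subschemeι)).subschemeι ≫ T'.subschemeι ≫ qZ)] :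
    ((((strictTransformIdeal π C T).comap s)).support : Set Zk) =
      closure (πk ⁻¹' ((((T.comap t).support : Set Yk)) \ ((C.comap t).support : Set Yk))) := by
  rw [comap_strictTransformIdeal_of_flat_traces k t hsq qZ HZ C T hE hmul htrace]
  exact support_strictTransformIdeal_eq_closure πk (C.comap t) (T.comap t)

end OneStep

end Literature.AlgebraicGeometry.Resolution

end
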